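import Mathlib
import Summits.NavierStokesRegularity.FluidComputer.AbcInertiaCount
import Summits.NavierStokesRegularity.FluidComputer.AbcClassIIComplexBasesCompleteness

/-!
# INERTIA-3L instantiation, Part 6: the COUNT as statements about EIGENVALUES — distinct eigenvalues,
# Jordan chains, classical class-II eigenfunctions (instab3 g8, cell `ns-blowup`, 2026-08-27)

HONEST FRAMING (human ruling D-0035): nothing here is a claim about Navier–Stokes blow-up.
WHAT THIS IS NOT: not NS evidence. MODEL lane (forced-ABC linearisation `L_R`, class II, certifier units,
coordinates of `AbcClassIIDefs`); no certificate, number or census word moves.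

`AbcInertiaCount.finrank_le_of_inertia_certificate` concludes: every finite-dimensional `L`-invariant
subspace `W` of rapidly decaying class-II coordinate vectors with `Re σ(L|_W) ≥ a` has `finrank W ≤ m`.
This file takes THAT CONCLUSION as a hypothesis `hcount` (so it applies verbatim to every certificate cell
`(R, a, m)`) and reads it as the words an INERTIA-3L certificate is booked for (PREREG-INERTIA-3L §1,
INSTAB3-METHOD §14.1, INERTIA-I4 §1):
* `card_eigenpairs_le` — `n` rapidly decaying coordinate eigenvectors with pairwise DISTINCT eigenvalues of
  real part `≥ a` ⇒ `n ≤ m` («at most `m` eigenvalues with `Re λ ≥ a`»);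
* `finrank_le_of_shift_nilpotent` — an invariant `W` killed by `(L − μ)^N`, `Re μ ≥ a` ⇒ `finrank W ≤ m`
  (ALGEBRAIC multiplicity `≤ m`); `no_jordan_chain_of_count_one` — for `m = 1`: no rapidly decaying `y` with
  `(L − μ) y = x` for an eigenvector `x` (the leader is algebraically SIMPLE);
* `card_classII_eigenfunctions_le` — `n` CLASSICAL eigenpairs `(z_k, u_k)` of the linearisation about
  `abcFlow 1 1 1` at viscosity `1/(2πR)` (`Torus.LinNSResolventRel … (2πz_k) u_k 0`, `u_k ≠ 0`) with class-II
  Fourier coefficients, pairwise distinct `z_k`, `Re z_k ≥ a` ⇒ `n ≤ m` (cert-3's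
  `AbcClassIIEigenpair.coords_of_classII_certifier_eigen` + `AbcLatticeEigenAnalysis`, instab4's basis `bfam`);
* `card_classII_eigenfunctions_le_of_inertia_certificate` — the same with the certificate facts (R1)(R2)(R3)
  as hypotheses (the END-TO-END kernel implication of an INERTIA-3L cell for classical class-II eigenvalues).
With the tree's enclosures (`CertificateAbcSpectrum.Row3002` etc., `AbcInertiaTranscript.a_lt_leader_4`) a
transcript reads off RIGHTMOST-NESS, SIMPLICITY and the SPECTRAL GAP of the certified leader.

Mathlib + `AbcInertiaCount` + `AbcClassIIComplexBasesCompleteness`; no new definitions; std axioms. [folklore]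
-/

noncomputable section

open scoped BigOperators ComplexConjugate Matrix
open Finset Matrix MeasureTheory UnitAddTorus

namespace Summit.NavierStokesRegularity.FluidComputer.AbcInertia

open Literature.Analysis.FunctionSpaces Literature.Analysis.FunctionSpaces.Torus
open Literature.Analysis.FluidPDE
open Summit.NavierStokesRegularity.FluidComputer.AbcClassII

/-! ### §1 The coordinate operator as a linear endomorphism; the rapidly decaying submodule -/

/-- The class-II coordinate operator `(L x)_i = −(|O_i|²/R) x_i + Σ_{j ∈ nbrIdx i} amat i j x_j` as a
complex-linear endomorphism of all coordinate vectors (finite row sums: no convergence involved). -/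
theorem exists_coordEnd (R : ℝ) : ∃ Lend : Module.End ℂ (Idx → ℂ), ∀ (x : Idx → ℂ) (i : Idx),
    Lend x i = ((-(onormSq i.1 / R) : ℝ) : ℂ) * x i + ∑ j ∈ nbrIdx i, ((amat i j : ℝ) : ℂ) * x j := by
  refine ⟨{ toFun := fun x i =>
              ((-(onormSq i.1 / R) : ℝ) : ℂ) * x i + ∑ j ∈ nbrIdx i, ((amat i j : ℝ) : ℂ) * x j
            map_add' := fun x y => ?_
            map_smul' := fun c x => ?_ }, fun x i => rfl⟩
  · funext i
    simp only [Pi.add_apply, mul_add, Finset.sum_add_distrib]; ring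
  · funext i
    simp only [Pi.smul_apply, smul_eq_mul, RingHom.id_apply]
    rw [mul_add, Finset.mul_sum]
    congr 1
    · ring
    · exact Finset.sum_congr rfl fun j _ => by ring

/-- The rapidly decaying coordinate vectors form a submodule. -/
theorem exists_rapidSubmodule : ∃ Rap : Submodule ℂ (Idx → ℂ), ∀ x : Idx → ℂ,
    x ∈ Rap ↔ ∀ s : ℕ, Summable fun i : Idx => (1 + onormSq i.1) ^ s * ‖x i‖ ^ 2 := by
  refine ⟨{ carrier := {x | ∀ s : ℕ, Summable fun i : Idx => (1 + onormSq i.1) ^ s * ‖x i‖ ^ 2}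
            add_mem' := fun {x y} hx hy s => ?_
            zero_mem' := fun s => ?_
            smul_mem' := fun c x hx s => ?_ }, fun x => Iff.rfl⟩
  · have hw : ∀ i : Idx, 0 ≤ (1 + onormSq i.1) ^ s := fun i => pow_nonneg (by linarith [onormSq_nonneg i.1]) _
    refine Summable.of_nonneg_of_le (fun i => mul_nonneg (hw i) (sq_nonneg _)) (fun i => ?_)
      (((hx s).add (hy s)).mul_left 2)
    have h := norm_add_le (x i) (y i)
    have h2 : ‖x i + y i‖ ^ 2 ≤ 2 * (‖x i‖ ^ 2 + ‖y i‖ ^ 2) := by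
      have hm := mul_le_mul h h (norm_nonneg _) (by positivity)
      nlinarith [sq_nonneg (‖x i‖ - ‖y i‖), hm]
    rw [Pi.add_apply]
    have := mul_le_mul_of_nonneg_left h2 (hw i)
    linarith
  · simp
  · refine ((hx s).mul_left (‖c‖ ^ 2)).congr fun i => ?_
    rw [Pi.smul_apply, norm_smul]; ring

/-- Iterating `x ↦ L x − μ x` on an eigenvector: `(L − μ)^[N] x = (ν − μ)^N • x` if `L x = ν x`. -/
theorem iterate_shift_eigen (Lend : Module.End ℂ (Idx → ℂ)) (μ ν : ℂ) {x : Idx → ℂ} (hx : Lend x = ν • x)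
    (N : ℕ) : ((Lend - μ • 1) ^ N) x = (ν - μ) ^ N • x := by
  induction N with
  | zero => simp
  | succ N ih =>
    rw [pow_succ, Module.End.mul_apply, LinearMap.sub_apply, LinearMap.smul_apply, Module.End.one_apply, hx,
      ← sub_smul, map_smul, ih, smul_smul, pow_succ']

/-! ### §2 Eigenvalue readings of the count -/

section Readings

variable {R a : ℝ} {m : ℕ}
variable (hcount : ∀ (W : Submodule ℂ (Idx → ℂ)), FiniteDimensional ℂ W →
  (∀ x ∈ W, ∀ s : ℕ, Summable fun i : Idx => (1 + onormSq i.1) ^ s * ‖x i‖ ^ 2) →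
  (∀ x ∈ W, (fun i : Idx => ((-(onormSq i.1 / R) : ℝ) : ℂ) * x i +
    ∑ j ∈ nbrIdx i, ((amat i j : ℝ) : ℂ) * x j) ∈ W) →
  (∀ (μ : ℂ) (x : Idx → ℂ), x ∈ W → x ≠ 0 →
    (∀ i : Idx, ((-(onormSq i.1 / R) : ℝ) : ℂ) * x i + ∑ j ∈ nbrIdx i, ((amat i j : ℝ) : ℂ) * x j = μ * x i) →
    a ≤ μ.re) →
  Module.finrank ℂ W ≤ m)

include hcount in
/-- **At most `m` eigenvalues with `Re λ ≥ a`.** `n` rapidly decaying coordinate eigenvectors of `L` with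
pairwise distinct eigenvalues of real part `≥ a` ⇒ `n ≤ m`. -/
theorem card_eigenpairs_le {n : ℕ} (μ : Fin n → ℂ) (hμ : Function.Injective μ) (x : Fin n → (Idx → ℂ))
    (hxr : ∀ (k : Fin n) (s : ℕ), Summable fun i : Idx => (1 + onormSq i.1) ^ s * ‖x k i‖ ^ 2)
    (hx0 : ∀ k, x k ≠ 0)
    (heig : ∀ (k : Fin n) (i : Idx), ((-(onormSq i.1 / R) : ℝ) : ℂ) * x k i +
      ∑ j ∈ nbrIdx i, ((amat i j : ℝ) : ℂ) * x k j = μ k * x k i)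
    (hre : ∀ k, a ≤ (μ k).re) : n ≤ m := by
  classical
  obtain ⟨Lend, hLend⟩ := exists_coordEnd R
  obtain ⟨Rap, hRap⟩ := exists_rapidSubmodule
  have hev : ∀ k, Lend.HasEigenvector (μ k) (x k) := by
    intro k
    refine ⟨Module.End.mem_eigenspace_iff.mpr ?_, hx0 k⟩
    funext i; rw [hLend, heig, Pi.smul_apply, smul_eq_mul]
  have hli : LinearIndependent ℂ x := Module.End.eigenvectors_linearIndependent' Lend μ hμ x hev
  set W : Submodule ℂ (Idx → ℂ) := Submodule.span ℂ (Set.range x) with hW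
  haveI : FiniteDimensional ℂ W := FiniteDimensional.span_of_finite ℂ (Set.finite_range x)
  have hfr : Module.finrank ℂ W = n := by rw [hW, finrank_span_eq_card hli, Fintype.card_fin]
  -- rapid decay on `W`
  have hWR : W ≤ Rap := by
    rw [hW]; refine Submodule.span_le.mpr ?_
    rintro _ ⟨k, rfl⟩; exact (hRap _).mpr (hxr k)
  -- invariance
  have hWinv : ∀ v ∈ W, Lend v ∈ W := by
    have hmap : W.map Lend ≤ W := by
      rw [hW, Submodule.map_span, Submodule.span_le]
      rintro _ ⟨_, ⟨k, rfl⟩, rfl⟩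
      rw [(hev k).apply_eq_smul]
      exact Submodule.smul_mem _ _ (Submodule.subset_span ⟨k, rfl⟩)
    intro v hv
    exact hmap (Submodule.mem_map_of_mem hv)
  -- eigenvalues within `W`
  have hWev : ∀ (ν : ℂ) (v : Idx → ℂ), v ∈ W → v ≠ 0 → Lend v = ν • v → a ≤ ν.re := by
    intro ν v hv hv0 hLv
    obtain ⟨c, rfl⟩ := (Submodule.mem_span_range_iff_exists_fun ℂ).mp (by rw [hW] at hv; exact hv)
    -- `Σ c_k (μ_k − ν) x_k = 0`
    have hzero : ∑ k, (c k * (μ k - ν)) • x k = 0 := by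
      have h1 : Lend (∑ k, c k • x k) = ∑ k, (c k * μ k) • x k := by
        rw [map_sum]
        refine Finset.sum_congr rfl fun k _ => ?_
        rw [map_smul, (hev k).apply_eq_smul, smul_smul]
      have h2 : ν • ∑ k, c k • x k = ∑ k, (c k * ν) • x k := by
        rw [Finset.smul_sum]
        refine Finset.sum_congr rfl fun k _ => ?_
        rw [smul_smul, mul_comm]
      have h3 : ∑ k, (c k * μ k) • x k - ∑ k, (c k * ν) • x k = 0 := by rw [← h1, ← h2, hLv, sub_self]
      rw [← Finset.sum_sub_distrib] at h3
      rw [← h3]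
      exact Finset.sum_congr rfl fun k _ => by rw [← sub_smul]; ring_nf
    have hck : ∀ k, c k * (μ k - ν) = 0 := Fintype.linearIndependent_iff.mp hli _ hzero
    obtain ⟨k, hk⟩ : ∃ k, c k ≠ 0 := by
      by_contra h
      push Not at h
      apply hv0
      exact Finset.sum_eq_zero fun k _ => by rw [h k, zero_smul]
    have : μ k = ν := by
      have := hck k
      rw [mul_eq_zero] at this
      exact sub_eq_zero.mp (this.resolve_left hk)
    rw [← this]; exact hre k
  have h := hcount W inferInstance (fun v hv => (hRap v).mp (hWR hv))
    (fun v hv => by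
      have : (fun i : Idx => ((-(onormSq i.1 / R) : ℝ) : ℂ) * v i + ∑ j ∈ nbrIdx i, ((amat i j : ℝ) : ℂ) * v j) =
          Lend v := by funext i; rw [hLend]
      rw [this]; exact hWinv v hv)
    (fun ν v hv hv0 hL => hWev ν v hv hv0 (by funext i; rw [hLend, hL i, Pi.smul_apply, smul_eq_mul]))
  rw [hfr] at h
  exact h

include hcount in
/-- **Algebraic multiplicity `≤ m`.** A finite-dimensional `L`-invariant subspace of rapidly decaying vectors
on which `L − μ` is NILPOTENT, `Re μ ≥ a`, has dimension `≤ m`. -/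
theorem finrank_le_of_shift_nilpotent (W : Submodule ℂ (Idx → ℂ)) [FiniteDimensional ℂ W]
    (hWs : ∀ x ∈ W, ∀ s : ℕ, Summable fun i : Idx => (1 + onormSq i.1) ^ s * ‖x i‖ ^ 2)
    (hWinv : ∀ x ∈ W, (fun i : Idx => ((-(onormSq i.1 / R) : ℝ) : ℂ) * x i +
      ∑ j ∈ nbrIdx i, ((amat i j : ℝ) : ℂ) * x j) ∈ W)
    (μ : ℂ) (hμ : a ≤ μ.re) (N : ℕ)
    (hnil : ∀ x ∈ W, (fun y : Idx → ℂ => fun i : Idx => ((-(onormSq i.1 / R) : ℝ) : ℂ) * y i +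
      ∑ j ∈ nbrIdx i, ((amat i j : ℝ) : ℂ) * y j - μ * y i)^[N] x = 0) :
    Module.finrank ℂ W ≤ m := by
  obtain ⟨Lend, hLend⟩ := exists_coordEnd R
  have hT : (fun y : Idx → ℂ => fun i : Idx => ((-(onormSq i.1 / R) : ℝ) : ℂ) * y i +
      ∑ j ∈ nbrIdx i, ((amat i j : ℝ) : ℂ) * y j - μ * y i) = ⇑(Lend - μ • 1) := by
    funext y i
    simp only [LinearMap.sub_apply, LinearMap.smul_apply, Module.End.one_apply, Pi.sub_apply, Pi.smul_apply,
      smul_eq_mul, hLend]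
  refine hcount W inferInstance hWs hWinv fun ν v hv hv0 hLv => ?_
  have hx : Lend v = ν • v := by funext i; rw [hLend, hLv i, Pi.smul_apply, smul_eq_mul]
  have h1 := hnil v hv
  rw [hT, ← Module.End.coe_pow, iterate_shift_eigen Lend μ ν hx N] at h1
  have h2 : (ν - μ) ^ N = 0 := by
    by_contra hne
    apply hv0
    have := congrArg (fun z => ((ν - μ) ^ N)⁻¹ • z) h1
    simpa [smul_smul, inv_mul_cancel₀ hne] using this
  have : ν = μ := sub_eq_zero.mp (pow_eq_zero_iff'.mp h2).1
  rw [this]; exact hμ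

/-- **Simplicity for `m = 1`: no Jordan chain.** If the count is `≤ 1`, an eigenvector `x` (rapidly decaying,
`L x = μ x`, `Re μ ≥ a`) admits no rapidly decaying `y` with `L y = μ y + x`. -/
theorem no_jordan_chain_of_count_one
    (hcount1 : ∀ (W : Submodule ℂ (Idx → ℂ)), FiniteDimensional ℂ W →
      (∀ x ∈ W, ∀ s : ℕ, Summable fun i : Idx => (1 + onormSq i.1) ^ s * ‖x i‖ ^ 2) →
      (∀ x ∈ W, (fun i : Idx => ((-(onormSq i.1 / R) : ℝ) : ℂ) * x i +
        ∑ j ∈ nbrIdx i, ((amat i j : ℝ) : ℂ) * x j) ∈ W) →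
      (∀ (μ : ℂ) (x : Idx → ℂ), x ∈ W → x ≠ 0 →
        (∀ i : Idx, ((-(onormSq i.1 / R) : ℝ) : ℂ) * x i + ∑ j ∈ nbrIdx i, ((amat i j : ℝ) : ℂ) * x j = μ * x i) →
        a ≤ μ.re) →
      Module.finrank ℂ W ≤ 1)
    (μ : ℂ) (hμ : a ≤ μ.re) (x y : Idx → ℂ)
    (hxr : ∀ s : ℕ, Summable fun i : Idx => (1 + onormSq i.1) ^ s * ‖x i‖ ^ 2)
    (hyr : ∀ s : ℕ, Summable fun i : Idx => (1 + onormSq i.1) ^ s * ‖y i‖ ^ 2) (hx0 : x ≠ 0)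
    (hx : ∀ i : Idx, ((-(onormSq i.1 / R) : ℝ) : ℂ) * x i + ∑ j ∈ nbrIdx i, ((amat i j : ℝ) : ℂ) * x j = μ * x i)
    (hy : ∀ i : Idx, ((-(onormSq i.1 / R) : ℝ) : ℂ) * y i + ∑ j ∈ nbrIdx i, ((amat i j : ℝ) : ℂ) * y j =
      μ * y i + x i) : False := by
  classical
  obtain ⟨Lend, hLend⟩ := exists_coordEnd R
  obtain ⟨Rap, hRap⟩ := exists_rapidSubmodule
  have hLx : Lend x = μ • x := by funext i; rw [hLend, hx i, Pi.smul_apply, smul_eq_mul]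
  have hLy : Lend y = μ • y + x := by funext i; rw [hLend, hy i, Pi.add_apply, Pi.smul_apply, smul_eq_mul]
  -- `x, y` are linearly independent
  have hli : LinearIndependent ℂ ![x, y] := by
    refine LinearIndependent.pair_iff.mpr fun s t hst => ?_
    have h1 : Lend (s • x + t • y) - μ • (s • x + t • y) = t • x := by
      rw [map_add, map_smul, map_smul, hLx, hLy]; module
    rw [hst, map_zero, smul_zero, sub_zero] at h1
    have ht : t = 0 := by
      by_contra ht
      apply hx0
      have := congrArg (fun z => t⁻¹ • z) h1
      simpa [smul_smul, inv_mul_cancel₀ ht] using this.symm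
    rw [ht, zero_smul, add_zero] at hst
    have hs : s = 0 := by
      by_contra hs
      apply hx0
      have := congrArg (fun z => s⁻¹ • z) hst
      simpa [smul_smul, inv_mul_cancel₀ hs] using this
    exact ⟨hs, ht⟩
  set W : Submodule ℂ (Idx → ℂ) := Submodule.span ℂ (Set.range ![x, y]) with hW
  haveI : FiniteDimensional ℂ W := FiniteDimensional.span_of_finite ℂ (Set.finite_range _)
  have hfr : Module.finrank ℂ W = 2 := by rw [hW, finrank_span_eq_card hli, Fintype.card_fin]
  have hWR : W ≤ Rap := by
    rw [hW]; refine Submodule.span_le.mpr ?_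
    rintro _ ⟨k, rfl⟩
    fin_cases k
    · exact (hRap _).mpr hxr
    · exact (hRap _).mpr hyr
  have hxW : x ∈ W := Submodule.subset_span ⟨0, rfl⟩
  have hyW : y ∈ W := Submodule.subset_span ⟨1, rfl⟩
  have hWinv : ∀ v ∈ W, Lend v ∈ W := by
    have hmap : W.map Lend ≤ W := by
      rw [hW, Submodule.map_span, Submodule.span_le]
      rintro _ ⟨_, ⟨k, rfl⟩, rfl⟩
      fin_cases k
      · change Lend x ∈ _; rw [hLx]; exact Submodule.smul_mem _ _ hxW
      · change Lend y ∈ _; rw [hLy]; exact Submodule.add_mem _ (Submodule.smul_mem _ _ hyW) hxW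
    exact fun v hv => hmap (Submodule.mem_map_of_mem hv)
  -- `(L − μ)² = 0` on `W`
  have hnil : ∀ v ∈ W, ((Lend - μ • 1) ^ (2 : ℕ)) v = 0 := by
    have hker : W ≤ LinearMap.ker ((Lend - μ • 1) ^ (2 : ℕ)) := by
      rw [hW]; refine Submodule.span_le.mpr ?_
      rintro _ ⟨k, rfl⟩
      rw [SetLike.mem_coe, LinearMap.mem_ker]
      fin_cases k
      · change ((Lend - μ • 1) ^ (2 : ℕ)) x = 0
        rw [pow_two, Module.End.mul_apply]
        simp [hLx]
      · change ((Lend - μ • 1) ^ (2 : ℕ)) y = 0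
        rw [pow_two, Module.End.mul_apply]
        simp [hLx, hLy]
    exact fun v hv => LinearMap.mem_ker.mp (hker hv)
  have h := finrank_le_of_shift_nilpotent hcount1 W (fun v hv => (hRap v).mp (hWR hv))
    (fun v hv => by
      have : (fun i : Idx => ((-(onormSq i.1 / R) : ℝ) : ℂ) * v i + ∑ j ∈ nbrIdx i, ((amat i j : ℝ) : ℂ) * v j) =
          Lend v := by funext i; rw [hLend]
      rw [this]; exact hWinv v hv)
    μ hμ 2 (fun v hv => by
      have hT : (fun z : Idx → ℂ => fun i : Idx => ((-(onormSq i.1 / R) : ℝ) : ℂ) * z i +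
          ∑ j ∈ nbrIdx i, ((amat i j : ℝ) : ℂ) * z j - μ * z i) = ⇑(Lend - μ • 1) := by
        funext z i
        simp only [LinearMap.sub_apply, LinearMap.smul_apply, Module.End.one_apply, Pi.sub_apply,
          Pi.smul_apply, smul_eq_mul, hLend]
      rw [hT, ← Module.End.coe_pow]; exact hnil v hv)
  omega

end Readings

/-! ### §3 Classical class-II eigenfunctions -/

section Classical

variable {R a : ℝ} {m : ℕ}

/-- **At most `m` CLASSICAL class-II eigenvalues with `Re z ≥ a`.** Given the count `hcount` for the cell
`(R, a, m)` (`R > 0`): `n` classical eigenpairs `(z_k, u_k)` of the linearisation about `abcFlow 1 1 1` at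
viscosity `1/(2πR)` with `u_k ≠ 0`, class-II Fourier coefficients, pairwise distinct `z_k` and
`Re z_k ≥ a` ⇒ `n ≤ m`. -/
theorem card_classII_eigenfunctions_le (hR : 0 < R)
    (hcount : ∀ (W : Submodule ℂ (Idx → ℂ)), FiniteDimensional ℂ W →
      (∀ x ∈ W, ∀ s : ℕ, Summable fun i : Idx => (1 + onormSq i.1) ^ s * ‖x i‖ ^ 2) →
      (∀ x ∈ W, (fun i : Idx => ((-(onormSq i.1 / R) : ℝ) : ℂ) * x i +
        ∑ j ∈ nbrIdx i, ((amat i j : ℝ) : ℂ) * x j) ∈ W) →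
      (∀ (μ : ℂ) (x : Idx → ℂ), x ∈ W → x ≠ 0 →
        (∀ i : Idx, ((-(onormSq i.1 / R) : ℝ) : ℂ) * x i + ∑ j ∈ nbrIdx i, ((amat i j : ℝ) : ℂ) * x j = μ * x i) →
        a ≤ μ.re) →
      Module.finrank ℂ W ≤ m)
    {n : ℕ} (z : Fin n → ℂ) (hz : Function.Injective z)
    (u : Fin n → UnitAddTorus (Fin 3) → EuclideanSpace ℂ (Fin 3))
    (hu : ∀ k, Torus.LinNSResolventRel (1 / (2 * Real.pi * R)) (Torus.abcFlow 1 1 1) (2 * Real.pi * z k) (u k) 0)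
    (hu0 : ∀ k, u k ≠ 0) (hII : ∀ k, IsClassII (mFourierCoeff (u k))) (hre : ∀ k, a ≤ (z k).re) :
    n ≤ m := by
  classical
  -- coordinates of each eigenfunction in instab4's basis `bfam`
  have hcoord : ∀ k, ∃ x : Idx → ℂ, x ≠ 0 ∧
      (∀ i : Idx, ((-(onormSq i.1 / R) : ℝ) : ℂ) * x i + ∑ j ∈ nbrIdx i, ((amat i j : ℝ) : ℂ) * x j = z k * x i) ∧
      ∀ s : ℕ, Summable fun i : Idx => (1 + onormSq i.1) ^ s * ‖x i‖ ^ 2 := by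
    intro k
    obtain ⟨hcr, hct, hc0, hL, hne⟩ :=
      AbcLatticeEigenAnalysis.certifier_eigen_of_linNSResolventRel_abcFlow 1 1 1 hR (z k) (hu k)
    have hL' : ∀ kk : Fin 3 → ℤ, ((-(freqNormSq kk / R) : ℝ) : ℂ) • mFourierCoeff (u k) kk +
        Torus.lerayCoeff kk (crossForm 1 1 1 (mFourierCoeff (u k)) kk) = z k • mFourierCoeff (u k) kk :=
      fun kk => hL kk
    exact AbcClassIIEigenpair.coords_of_classII_certifier_eigen bfam bfam_apply_of_not_mem
      (fun i kk => (bfam_spec i).1 kk) (fun i => (bfam_spec i).2.1) sum_inner_bfam_same_orbit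
      (fun i j => ((amat i j : ℝ) : ℂ)) (fun i j => amat_eq i j) (z k) hcr hct hc0 (hII k) hL' (hne (hu0 k))
  choose x hx0 hxe hxr using hcoord
  exact card_eigenpairs_le hcount z hz x hxr hx0 hxe hre

/-- **INERTIA-3L, END TO END (class II, classical form).** Certificate facts (R1)(R2)(R3) for the cell
`(R, a, m)` with index radii `r_L + 1 ≤ r_H` and a symmetric head weight `GH` on `H` ⇒ the linearisation of
forced Navier–Stokes about `abcFlow 1 1 1` at viscosity `1/(2πR)` has AT MOST `m` pairwise distinct
classical class-II eigenvalues `z` (eigenvalue `2πz` of `Torus.LinNSResolventRel`) with `Re z ≥ a`. -/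
theorem card_classII_eigenfunctions_le_of_inertia_certificate {rL rH : ℝ} {HL HH HB : Finset Idx}
    (hR : 0 < R) (h0 : 0 ≤ rL) (hLH : rL + 1 ≤ rH)
    (hHL : ∀ i : Idx, i ∈ HL ↔ onormSq i.1 ≤ rL ^ 2)
    (hHH : ∀ i : Idx, i ∈ HH ↔ onormSq i.1 ≤ rH ^ 2)
    (hHB : ∀ i : Idx, i ∈ HB ↔ rH ^ 2 < onormSq i.1 ∧ onormSq i.1 ≤ (rH + 1) ^ 2)
    (GH Ah : Matrix ↥HH ↥HH ℝ) (AHB : Matrix ↥HH ↥HB ℝ) (ABH : Matrix ↥HB ↥HH ℝ) (E : ↥HB → ℝ)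
    (V : Matrix ↥HH (Fin m) ℝ) (hGH : GHᵀ = GH)
    (hAh : Ah = Matrix.of fun i j : ↥HH => (if i = j then -(onormSq i.1.1 / R) - a else 0) + amat i.1 j.1)
    (hAHB : AHB = Matrix.of fun (i : ↥HH) (l : ↥HB) => amat i.1 l.1)
    (hABH : ABH = Matrix.of fun (l : ↥HB) (i : ↥HH) => amat l.1 i.1)
    (hE : E = fun l : ↥HB => onormSq l.1.1 / R + a - Real.sqrt 2)
    (hR1 : ∀ x : ↥HH → ℝ, x ≠ 0 →
      x ⬝ᵥ ((GH * Ah + Ahᵀ * GH + (1 / 2 : ℝ) • ((GH * AHB + ABHᵀ) * Matrix.diagonal (fun l => (E l)⁻¹) *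
        (GH * AHB + ABHᵀ)ᵀ)) *ᵥ x) < 0)
    (hR2 : ∀ x : ↥HH → ℝ, 0 ≤ x ⬝ᵥ ((GH + V * Vᵀ) *ᵥ x))
    (hR3 : Real.sqrt 2 < ((⌊rH ^ 2⌋₊ : ℝ) + 1) / R + a)
    {n : ℕ} (z : Fin n → ℂ) (hz : Function.Injective z)
    (u : Fin n → UnitAddTorus (Fin 3) → EuclideanSpace ℂ (Fin 3))
    (hu : ∀ k, Torus.LinNSResolventRel (1 / (2 * Real.pi * R)) (Torus.abcFlow 1 1 1) (2 * Real.pi * z k) (u k) 0)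
    (hu0 : ∀ k, u k ≠ 0) (hII : ∀ k, IsClassII (mFourierCoeff (u k))) (hre : ∀ k, a ≤ (z k).re) :
    n ≤ m :=
  card_classII_eigenfunctions_le hR
    (fun W hW hWs hWinv hWev => by
      haveI := hW
      exact finrank_le_of_inertia_certificate hR h0 hLH hHL hHH hHB GH Ah AHB ABH E V hGH hAh hAHB hABH hE
        hR1 hR2 hR3 W hWs hWinv hWev)
    z hz u hu hu0 hII hre

end Classical

end Summit.NavierStokesRegularity.FluidComputer.AbcInertia

end
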